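/-
Copyright (c) 2026 the pub-hodgecm-mathlib formalisation cell (harness21).  Prover seat hodgecm-mathlib-K2E4-p14 (g13) (VALVE 26 (ff) hand routed to S8), Track B ∕ K2-LIT,
h413 = `stmt-HodgeConjecture-24833`, R90-TF section S8 «ContSpec-n½», deal S8-R239 (2) (S8 dealer R90-CS-plan (g3), 2026-09-05T02:59:18Z; census on the R90 bus 03:01:42Z):
the `(L²_cusp)ᗮ` half of sub-socket (R) FOR THE GENERATORS OF RECORD — letters (a)(b) of ★ `R90S8ResGMidAtomOrthogonalCuspidalU3` PAID from the χ-exports' truncated family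
(★ T estate) and the ★ χ-pair tube seed, letters (c)(d) kept as ONE named residue letter.
-/
import Summits.HodgeConjecture.HodgeConjecture.Theorems.R90S8ResGMidAtomOrthogonalCuspidalU3                 -- ★ (K2E1-p12 (g4)): `inner_cuspFormsToLp_eq_zero_of_midResidue_letters`, `inner_eq_zero_of_mem_cuspidalSubspace_of_forall_cuspFormsToLp`, `resGMidAtomGen` currency (★ D1)
import Summits.HodgeConjecture.HodgeConjecture.Theorems.K2E1ChiEisensteinPairTubeSeedCuspOrthogonalCMThree   -- ★ (K2E2-p12 (g9)): `tubeSeed_pair_cm_three_of_letters` (letter (a) token for token); brings ★ `memLp_quotFun_truncation_eisensteinSeriesU_flatSectionU_cm_three` ((Tr))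
import Summits.HodgeConjecture.HodgeConjecture.Theorems.K2E1ChiEisensteinLeftInvarianceOffPolesCMThree        -- ★ (K2E1 estate): `isPreconnected_compl_of_codiscrete` (the complement of the χ pole set is preconnected)
import Summits.HodgeConjecture.HodgeConjecture.Theorems.K2E1EisensteinConstantTermIntertwinedBoundLevelU3     -- ED. 2: ★ (LH4-p10 (g9)) `hMbd_pair_cm_three` — the [MW II.1.7] tail letter `hMbd` PAID by name
import Summits.HodgeConjecture.HodgeConjecture.Theorems.K2E1ChiTruncatedEisensteinBoundedCMThree                -- ED. 2: ★ (K2E2-p12 (g9)) `hTr_cm_three_free` — the spherical (Tr) letter PAID letter-free (domination)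
import HarnessLib

/-!
# S8 sub-socket (R), the `(L²_cusp)ᗮ` half FOR THE GENERATORS OF RECORD — `R90S8ResGMidAtomOrthogonalCuspidalOfRecordU3`: letters (a) TUBE SEED and (b) HOLOMORPHIC FAMILY of ★
# `resGMidAtomGen_inner_cuspidal_eq_zero_of_letters` DISCHARGED from the χ-Eisenstein exports with the truncated `L²` family (★ T estate, (E1)+(E6)) and the ★ χ-pair tube seed;
# (c)+(d) kept as ONE named `L²`-residue letter

Track B ∕ K2-LIT, crux h413 = `stmt-HodgeConjecture-24833`, route of record `HCCMUnconditional`; cell `hodgecm-mathlib`, R90-TF programme, section S8 «ContSpec-n½», socket #2 ∕ #3 via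
B's sub-socket (R) `sock_S8_res_midBlock_le_residual`.  THEOREMS ONLY (no `def`, no `instance`, no `notation`, no named-fact hypothesis, no `sorry`; default heartbeats); ★-only imports;
lane `--supports stmt-HodgeConjecture-24833 --as helper` (count-neutral).  CLOSES NO SOCKET.

WHAT.  ★ `R90S8ResGMidAtomOrthogonalCuspidalU3` (K2E1-p12) pays the `hcusp` bytes of ★ p862741 MODULO four per-generator letters: (a) the χ-pair TUBE SEED `hseed`, (b) a truncated
`L²`-family `F` holomorphic on an open preconnected `D ∋ σ₀ > 2` reaching a punctured neighbourhood of `3∕2`, (c) the RESIDUE LETTER `hlim : (z − 3∕2)•F z + corr → f`, (d) `hcorr`.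
CENSUS AGAINST THE T EXPORTS (bus 03:01:42Z): (b) is SUPPLIED by the χ-Eisenstein exports of record (★ `…KFiniteWithTruncatedFamily` (E1)+(E6), ★ `hE6_midWitness` transport): `F := Fam`
of (E6), `D := Pᶜ` for the exports' closed co-discrete pole set `P ⊆ {Re ≤ 2}` (open; PRECONNECTED by ★ `isPreconnected_compl_of_codiscrete`; `σ₀ := 3`; `𝓝[≠] (3∕2) ≤ 𝓟 Pᶜ` by
co-discreteness); (a) is ★ `tubeSeed_pair_cm_three_of_letters` (K2E2-p12 (g9)) at `(Ec, Pᶜ, Fam)` — token for token — modulo ITS OWN two visible letters, the tail bound `hMbd`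
([MoeglinWaldspurger1995] II.1.7 at `N = 3`, no ★ payer) and the spherical (Tr) letter, the latter PAID here by ★ `memLp_quotFun_truncation_eisensteinSeriesU_flatSectionU_cm_three` down to
the decay letter `hdec` at the constant section; (c)+(d) have no ★ payer (the `L²` removable-singularity argument AT THE GENUINE POLE `3∕2` plus the Siegel-top correction — ★ removable-free
`K2E1ChiTruncatedFamilyRemovableFreeCMThree` treats FAKE poles only) and are kept as ONE named letter `hRES : ∃ corr, Tendsto ((z − 3∕2)•Fam z + corr) (𝓝[≠] 3∕2) (𝓝 f) ∧ ∀ φ̂, ⟪φ̂, corr⟫ = 0`.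
* §1 **`inner_cuspidal_eq_zero_of_truncatedFamily_exports`** — ONE generator: pair-section data `(hφ : IsChiSectionPair χ₁ χ₂ φ) (hφc) (hφM)`, `χ₂` automorphic, the Heisenberg
  package `(ν, 𝓕)`, `𝔓.radical i = N(𝔸)`, the exports' continuation `Ec` with pole set `P` ((E1) clauses + tube identity) and (E6)'s family `Fam` at a level `T ≥ 1`, the letters `hMbd`,
  `hdec`, `hRES` ⊢ `⟪u, f⟫ = 0` for all `u ∈ L²_cusp(𝔓)`.
* §2 **`resGMidAtomGen_inner_cuspidal_eq_zero_of_exportsLetters`** — ★ §4's head with its per-generator ∃-package REPLACED by the exports package + `{hMbd, hdec, hRES}` (letter (b)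
  gone, letter (a) reduced); **`resGMidAtom_le_orthogonal_cuspidal_of_exportsLetters`** — atom level (★ `resGMidAtom_le_of_gen_subset`).
* §3 (EDITION 2, S8-R245 «bind `hMbd` BY NAME»): **`inner_cuspidal_eq_zero_of_truncatedFamily_exports_free`**, **`resGMidAtomGen_inner_cuspidal_eq_zero_of_exportsResidueLetter`**,
  **`resGMidAtom_le_orthogonal_cuspidal_of_exportsResidueLetter`** — §1∕§2 with `hMbd` PAID by ★ `hMbd_pair_cm_three` (LH4-p10 (g9)) and `hdec`∕(Tr) PAID by ★ `hTr_cm_three_free`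
  (K2E2-p12 (g9)): letters (a)+(b) FULLY discharged from the exports; ONLY `hRES` ((c)+(d)) remains per generator.
HONEST LABEL: HC_CM is proved only modulo the 7 printed citations (2 remaining named inputs: hLiu418 = `stmt-HodgeConjecture-24832`, h413 = `stmt-HodgeConjecture-24833`) until rung 0
closes; REL ≠ ★ ≠ BUILT; this file asserts no named fact, is conditional by construction on `{hMbd, hdec, hRES}` (§1–§2) ∕ `{hRES}` alone (§3, ED. 2) (and the exports row, ★ only at admissible levels — F1 of ★
`R90S8ResGMidBlockHContOfRecordU3`), and closes no socket — (R) stays OPEN modulo `hdisc` + these letters; count-neutral.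

## References
* [MoeglinWaldspurger1995] C. Mœglin, J.-L. Waldspurger, *Spectral Decomposition and Eisenstein Series* (1995), I.2.13, II.1.7–II.1.8, IV.1.9–IV.1.11, V.3.13.
* [BernsteinLapid2019] J. Bernstein, E. Lapid, *On the meromorphic continuation of Eisenstein series*, J. AMS 37 (2024), Thm 2.3, §4 Claim 2.
* [Rogawski1990] J. D. Rogawski, *Automorphic Representations of Unitary Groups in Three Variables* (1990), §13.9 p. 229 (ii).
* [Conway1978] J. B. Conway, *Functions of One Complex Variable*, 2nd ed. (1978), IV §3 (identity theorem; complements of countable sets are connected).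
-/

set_option autoImplicit false
set_option linter.dupNamespace false  -- the mandated namespace `…HodgeConjecture.HodgeConjecture.R90.S8` (LEAD #1 L1) repeats the summit's segment

noncomputable section

open MeasureTheory Measure Set Filter Topology NumberField IsDedekindDomain ContRepresentation
open scoped ENNReal NNReal InnerProductSpace
open Literature.NumberTheory Literature.NumberTheory.Automorphic Literature.NumberTheory.Automorphic.UnitaryGroup Literature.NumberTheory.GaloisRepresentations AdelicGroupData
open Literature.NumberTheory.Automorphic.Arthur2013.Leaves.TECR Literature.NumberTheory.Rogawski1990
open Summit.HodgeConjecture.HodgeConjecture.Cruxes.H413.K2E1BorelEisensteinU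
open Summit.HodgeConjecture.HodgeConjecture.Cruxes.H413.K2E1TruncatedEisensteinExplicit
open Summit.HodgeConjecture.HodgeConjecture.Cruxes.H413.K2E1BLBorelSpacesU2Defs
open Summit.HodgeConjecture.HodgeConjecture.Cruxes.H413.K2E1CharacterEisensteinU3PairDefs Summit.HodgeConjecture.HodgeConjecture.Cruxes.H413.K2E1ChiSectionSpaceU3PairDefs
open Summit.HodgeConjecture.HodgeConjecture.Cruxes.H413.K2E1ChiEisensteinPairTubeSeedCuspOrthogonalCMThree (tubeSeed_pair_cm_three_of_letters)
open Summit.HodgeConjecture.HodgeConjecture.Cruxes.H413.K2E1TruncatedEisensteinBoundedCMThree (memLp_quotFun_truncation_eisensteinSeriesU_flatSectionU_cm_three)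
open Summit.HodgeConjecture.HodgeConjecture.Cruxes.H413.K2E1ChiEisensteinLeftInvarianceOffPolesCMThree (isPreconnected_compl_of_codiscrete)
open Summit.HodgeConjecture.HodgeConjecture.Cruxes.H413.K2E1EisensteinConstantTermIntertwinedBoundLevelU3 (hMbd_pair_cm_three)
open Summit.HodgeConjecture.HodgeConjecture.Cruxes.H413.K2E1ChiTruncatedEisensteinBoundedCMThree (hTr_cm_three_free)

namespace Summit.HodgeConjecture.HodgeConjecture.R90.S8

variable (L : Type) [Field L] [NumberField L] [IsCMField L]
variable [MeasurableSpace (quasiSplit (↥(maximalRealSubfield L)) L (IsCMField.complexConj L) 3).Adelic] [BorelSpace (quasiSplit (↥(maximalRealSubfield L)) L (IsCMField.complexConj L) 3).Adelic]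
variable (μ : Measure (quasiSplit (↥(maximalRealSubfield L)) L (IsCMField.complexConj L) 3).automorphicQuotient) [(quasiSplit (↥(maximalRealSubfield L)) L (IsCMField.complexConj L) 3).IsAutomorphicMeasure μ]
  (𝔓 : (quasiSplit (↥(maximalRealSubfield L)) L (IsCMField.complexConj L) 3).ParabolicUnipotentData)

/-! ## §1 One generator: (a) and (b) from the exports with the truncated family; (c)+(d) as ONE named residue letter -/

/-- **`⟪u, f⟫ = 0` FOR EVERY `u ∈ L²_cusp`, FROM THE χ-EXPORTS WITH THE TRUNCATED FAMILY, MODULO `{hMbd, hdec, hRES}`** — ONE generator.  Data: a CONTINUOUS BOUNDED `(χ₁, χ₂)`-pair section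
`φ` (`χ₂` automorphic), the Heisenberg package `(ν, 𝓕)` and `𝔓.radical i = N(𝔸)` (as in the ★ tube seed), the exports' continuation `Ec` of `z ↦ E(φH^z)` with its CLOSED CO-DISCRETE
pole set `P ⊆ {Re ≤ 2}` and tube identity ((E1) of ★ `…KFiniteWithTruncatedFamily`), and (E6)'s truncated `L²` family `Fam` at a level `T ≥ 1` (holomorphic on `Pᶜ`, `Fam z =ᵐ Λ^T(Ec z)`).
Letters: `hMbd` (the [MW II.1.7] tail bound at the tube points off `P`), `hdec` (the decay letter of the SPHERICAL truncated series at real `σ > 2`, feeding (Tr) through ★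
`memLp_quotFun_truncation_eisensteinSeriesU_flatSectionU_cm_three`), `hRES` (the `L²` residue letter at `3∕2` with a cusp-orthogonal correction).  Proof: ★ `inner_cuspFormsToLp_eq_zero_of_midResidue_letters`
at `D := Pᶜ` (open, preconnected by ★ `isPreconnected_compl_of_codiscrete`, `σ₀ := 3`, `𝓝[≠](3∕2)`-eventually in `Pᶜ`), with the seed = ★ `tubeSeed_pair_cm_three_of_letters`; then the
closure step ★ `inner_eq_zero_of_mem_cuspidalSubspace_of_forall_cuspFormsToLp`. [cite: MoeglinWaldspurger1995, IV.1.11, II.1.7–II.1.8, I.2.13] [cite: BernsteinLapid2019, §4 Claim 2]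
[cite: Rogawski1990, §13.9 p. 229 (ii)] [cite: Conway1978, IV §3] -/
theorem inner_cuspidal_eq_zero_of_truncatedFamily_exports (i : 𝔓.ι)
    (h𝔓 : 𝔓.radical i = adelicUnipotent (↥(maximalRealSubfield L)) L (IsCMField.complexConj L) 3)
    (ν : Measure ↥(adelicUnipotent (↥(maximalRealSubfield L)) L (IsCMField.complexConj L) 3)) [ν.IsHaarMeasure]
    {𝓕 : Set ↥(adelicUnipotent (↥(maximalRealSubfield L)) L (IsCMField.complexConj L) 3)}
    (h𝓕N : IsFundamentalDomain ↥(rationalUnipotent (↥(maximalRealSubfield L)) L (IsCMField.complexConj L) 3) 𝓕 ν) (h𝓕c : IsCompact (closure 𝓕))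
    -- the pair section of record
    {χ₁ : HeckeCharacter L} {χ₂ : ↥(TorusDict.torus (IsCMField.complexConj L)) →ₜ* ℂˣ} (hχ₂ : TorusDict.IsAutomorphic (IsCMField.complexConj L) χ₂)
    {φ : (quasiSplit (↥(maximalRealSubfield L)) L (IsCMField.complexConj L) 3).Adelic → ℂ}
    (hφ : IsChiSectionPair (F := ↥(maximalRealSubfield L)) χ₁ χ₂ φ) (hφc : Continuous φ) {M : ℝ} (hφM : ∀ x, ‖φ x‖ ≤ M)
    -- the exports' continuation with its pole set ((E1) clauses) and the tube identity
    {Ec : ℂ → (quasiSplit (↥(maximalRealSubfield L)) L (IsCMField.complexConj L) 3).Adelic → ℂ} {P : Set ℂ}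
    (hPc : IsClosed P) (hPcd : ∀ z₀ : ℂ, ∀ᶠ s in 𝓝[≠] z₀, s ∉ P) (hP2 : ∀ z ∈ P, z.re ≤ 2)
    (hE2 : ∀ z : ℂ, 2 < z.re → Ec z = eisensteinSeriesU (flatSectionU φ z))
    -- (E6): the truncated `L²` family at a level `T ≥ 1`
    {T : ℝ≥0} (hT : 1 ≤ T) (Fam : ℂ → (quasiSplit (↥(maximalRealSubfield L)) L (IsCMField.complexConj L) 3).L2 μ) (hFd : DifferentiableOn ℂ Fam Pᶜ)
    (hFam : ∀ z : ℂ, z ∉ P → ((Fam z : (quasiSplit (↥(maximalRealSubfield L)) L (IsCMField.complexConj L) 3).L2 μ) :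
        (quasiSplit (↥(maximalRealSubfield L)) L (IsCMField.complexConj L) 3).automorphicQuotient → ℂ) =ᵐ[μ]
      (quasiSplit (↥(maximalRealSubfield L)) L (IsCMField.complexConj L) 3).quotFun (truncation ν 𝓕 T (Ec z)))
    -- VISIBLE LETTER `hMbd` ([MoeglinWaldspurger1995] II.1.7 tail bound at the tube points off `P`)
    (hMbd : ∀ z : ℂ, z ∉ P → 2 < z.re → ∃ C : ℝ, ∀ g : (quasiSplit (↥(maximalRealSubfield L)) L (IsCMField.complexConj L) 3).Adelic, T < borelHeight g →
      ‖borelConstantTerm ν 𝓕 (eisensteinSeriesU (flatSectionU φ z)) g - flatSectionU φ z g‖ ≤ C)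
    -- VISIBLE LETTER `hdec` (decay of the SPHERICAL truncated series above the floor at real `σ > 2`; pays (Tr) through ★ `memLp_quotFun_truncation_…_cm_three`)
    (hdec : ∀ σ : ℝ, 2 < σ → ∃ M₁ : ℝ, ∀ g : (quasiSplit (↥(maximalRealSubfield L)) L (IsCMField.complexConj L) 3).Adelic, T < borelHeight g →
      ‖eisensteinSeriesU (flatSectionU (fun _ : (quasiSplit (↥(maximalRealSubfield L)) L (IsCMField.complexConj L) 3).Adelic => ((M : ℝ) : ℂ)) ((σ : ℝ) : ℂ)) g -
        borelConstantTerm ν 𝓕 (eisensteinSeriesU (flatSectionU (fun _ : (quasiSplit (↥(maximalRealSubfield L)) L (IsCMField.complexConj L) 3).Adelic => ((M : ℝ) : ℂ)) ((σ : ℝ) : ℂ))) g‖ ≤ M₁)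
    -- VISIBLE LETTER `hRES` ((c)+(d): the `L²` residue letter at `3∕2` with a cusp-orthogonal correction)
    (f : (quasiSplit (↥(maximalRealSubfield L)) L (IsCMField.complexConj L) 3).L2 μ)
    (hRES : ∃ corr : (quasiSplit (↥(maximalRealSubfield L)) L (IsCMField.complexConj L) 3).L2 μ,
      Tendsto (fun z : ℂ => (z - (3 : ℂ) / 2) • Fam z + corr) (𝓝[≠] ((3 : ℂ) / 2)) (𝓝 f) ∧
      ∀ ψ : ↥((quasiSplit (↥(maximalRealSubfield L)) L (IsCMField.complexConj L) 3).cuspForms μ 𝔓),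
        ⟪(quasiSplit (↥(maximalRealSubfield L)) L (IsCMField.complexConj L) 3).cuspFormsToLp μ 𝔓 ψ, corr⟫_ℂ = 0) :
    ∀ u ∈ (quasiSplit (↥(maximalRealSubfield L)) L (IsCMField.complexConj L) 3).cuspidalSubspace μ 𝔓,
      ⟪(u : (quasiSplit (↥(maximalRealSubfield L)) L (IsCMField.complexConj L) 3).L2 μ), f⟫_ℂ = 0 := by
  obtain ⟨corr, hlim, hcorr⟩ := hRES
  -- (b): the domain `D := Pᶜ`
  have hDo : IsOpen Pᶜ := hPc.isOpen_compl
  have hDc : IsPreconnected Pᶜ := isPreconnected_compl_of_codiscrete hPcd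
  have hσD : ∀ᶠ z in 𝓝 (((3 : ℝ) : ℝ) : ℂ), z ∈ Pᶜ := by
    have hopen : ∀ᶠ z in 𝓝 (((3 : ℝ) : ℝ) : ℂ), 2 < z.re :=
      (Complex.continuous_re.isOpen_preimage _ isOpen_Ioi).mem_nhds (by simp only [mem_preimage, Complex.ofReal_re, mem_Ioi]; norm_num)
    filter_upwards [hopen] with z hz hzP
    exact absurd (hP2 z hzP) (not_le.2 hz)
  have hD32 : ∀ᶠ z in 𝓝[≠] ((3 : ℂ) / 2), z ∈ Pᶜ := hPcd _
  -- (a): the tube seed, with (Tr) paid from `hdec`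
  have hTr : ∀ σ : ℝ, 2 < σ → MemLp ((quasiSplit (↥(maximalRealSubfield L)) L (IsCMField.complexConj L) 3).quotFun
      (truncation ν 𝓕 T (eisensteinSeriesU (flatSectionU (fun _ : (quasiSplit (↥(maximalRealSubfield L)) L (IsCMField.complexConj L) 3).Adelic => ((M : ℝ) : ℂ)) ((σ : ℝ) : ℂ))))) 2 μ := by
    intro σ hσ
    obtain ⟨M₁, hM₁⟩ := hdec σ hσ
    exact memLp_quotFun_truncation_eisensteinSeriesU_flatSectionU_cm_three L ν h𝓕N hT (z := ((σ : ℝ) : ℂ)) (by rwa [Complex.ofReal_re]) continuous_const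
      (fun _ => (Complex.norm_real M).le) (fun _ _ _ => rfl) hM₁ μ 2
  have hseed := tubeSeed_pair_cm_three_of_letters L μ ν h𝓕N h𝓕c 𝔓 i h𝔓 hχ₂ hφ hφc hφM hT Ec Pᶜ (fun z _ hz => hE2 z hz)
    (fun z hz hz2 => hMbd z hz hz2) hTr Fam (fun z hz => hFam z hz)
  -- §2 of ★ letters file, then the closure step
  exact inner_eq_zero_of_mem_cuspidalSubspace_of_forall_cuspFormsToLp L μ 𝔓 f
    (inner_cuspFormsToLp_eq_zero_of_midResidue_letters L μ 𝔓 Fam hDo hDc hFd (by norm_num : (2 : ℝ) < 3) hσD hD32 hseed f corr hlim hcorr)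

/-! ## §2 ★ §4's `hcusp` letter for the generators of the atom at one level, over the exports package + `{hMbd, hdec, hRES}` -/

variable (ξ : OneDimAutRepH L) (μω : HeckeCharacter L)
  (K' : Subgroup (quasiSplit (↥(maximalRealSubfield L)) L (IsCMField.complexConj L) 3).Adelic) (ω : ↥K' →* ℂ)

/-- **★ p862741's `hcusp` BYTES AT ONE LEVEL `(K′, ω)`, FROM THE EXPORTS PACKAGE + `{hMbd, hdec, hRES}`** — the head of ★ `resGMidAtomGen_inner_cuspidal_eq_zero_of_letters` with its
per-generator ∃-package REPLACED: instead of letters (a)–(d) each generator `f` comes with a continuous bounded pair section `φ` of the block's characters `(η̃⁻¹ψ̃⁻¹μ, ψ)`, the exports'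
continuation `Ec` (pole set `P` closed, co-discrete, `⊆ {Re ≤ 2}`; tube identity), (E6)'s family `Fam` at a level `T ≥ 1`, and the THREE letters `hMbd`, `hdec`, `hRES` of §1 (letter (b) is
GONE, letter (a) is REDUCED to `{hMbd, hdec}`).  One Heisenberg package `(ν, 𝓕)` and `𝔓.radical i = N(𝔸)` for all generators; `χ₂ := ξ.ψ` automorphic by `ξ.hψ`.
[cite: MoeglinWaldspurger1995, IV.1.11, V.3.13] [cite: Rogawski1990, §13.9 p. 229 (ii)] [cite: BernsteinLapid2019, §4 Claim 2] -/
theorem resGMidAtomGen_inner_cuspidal_eq_zero_of_exportsLetters (i : 𝔓.ι)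
    (h𝔓 : 𝔓.radical i = adelicUnipotent (↥(maximalRealSubfield L)) L (IsCMField.complexConj L) 3)
    (ν : Measure ↥(adelicUnipotent (↥(maximalRealSubfield L)) L (IsCMField.complexConj L) 3)) [ν.IsHaarMeasure]
    {𝓕 : Set ↥(adelicUnipotent (↥(maximalRealSubfield L)) L (IsCMField.complexConj L) 3)}
    (h𝓕N : IsFundamentalDomain ↥(rationalUnipotent (↥(maximalRealSubfield L)) L (IsCMField.complexConj L) 3) 𝓕 ν) (h𝓕c : IsCompact (closure 𝓕))
    (hL : ∀ f ∈ resGMidAtomGen L μ ξ μω K' ω,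
      ∃ (φ : (quasiSplit (↥(maximalRealSubfield L)) L (IsCMField.complexConj L) 3).Adelic → ℂ) (M : ℝ) (Ec : ℂ → (quasiSplit (↥(maximalRealSubfield L)) L (IsCMField.complexConj L) 3).Adelic → ℂ) (P : Set ℂ) (T : ℝ≥0) (Fam : ℂ → (quasiSplit (↥(maximalRealSubfield L)) L (IsCMField.complexConj L) 3).L2 μ) (corr : (quasiSplit (↥(maximalRealSubfield L)) L (IsCMField.complexConj L) 3).L2 μ),
        IsChiSectionPair (F := ↥(maximalRealSubfield L)) (ξ.bcη⁻¹ * ξ.bcψ⁻¹ * μω) ξ.ψ φ ∧ Continuous φ ∧ (∀ x, ‖φ x‖ ≤ M) ∧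
        IsClosed P ∧ (∀ z₀ : ℂ, ∀ᶠ s in 𝓝[≠] z₀, s ∉ P) ∧ (∀ z ∈ P, z.re ≤ 2) ∧ (∀ z : ℂ, 2 < z.re → Ec z = eisensteinSeriesU (flatSectionU φ z)) ∧
        1 ≤ T ∧ DifferentiableOn ℂ Fam Pᶜ ∧
        (∀ z : ℂ, z ∉ P → ((Fam z : (quasiSplit (↥(maximalRealSubfield L)) L (IsCMField.complexConj L) 3).L2 μ) : (quasiSplit (↥(maximalRealSubfield L)) L (IsCMField.complexConj L) 3).automorphicQuotient → ℂ) =ᵐ[μ] (quasiSplit (↥(maximalRealSubfield L)) L (IsCMField.complexConj L) 3).quotFun (truncation ν 𝓕 T (Ec z))) ∧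
        (∀ z : ℂ, z ∉ P → 2 < z.re → ∃ C : ℝ, ∀ g : (quasiSplit (↥(maximalRealSubfield L)) L (IsCMField.complexConj L) 3).Adelic, T < borelHeight g →
          ‖borelConstantTerm ν 𝓕 (eisensteinSeriesU (flatSectionU φ z)) g - flatSectionU φ z g‖ ≤ C) ∧
        (∀ σ : ℝ, 2 < σ → ∃ M₁ : ℝ, ∀ g : (quasiSplit (↥(maximalRealSubfield L)) L (IsCMField.complexConj L) 3).Adelic, T < borelHeight g →
          ‖eisensteinSeriesU (flatSectionU (fun _ : (quasiSplit (↥(maximalRealSubfield L)) L (IsCMField.complexConj L) 3).Adelic => ((M : ℝ) : ℂ)) ((σ : ℝ) : ℂ)) g -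
            borelConstantTerm ν 𝓕 (eisensteinSeriesU (flatSectionU (fun _ : (quasiSplit (↥(maximalRealSubfield L)) L (IsCMField.complexConj L) 3).Adelic => ((M : ℝ) : ℂ)) ((σ : ℝ) : ℂ))) g‖ ≤ M₁) ∧
        Tendsto (fun z : ℂ => (z - (3 : ℂ) / 2) • Fam z + corr) (𝓝[≠] ((3 : ℂ) / 2)) (𝓝 f) ∧
        ∀ ψ : ↥((quasiSplit (↥(maximalRealSubfield L)) L (IsCMField.complexConj L) 3).cuspForms μ 𝔓), ⟪(quasiSplit (↥(maximalRealSubfield L)) L (IsCMField.complexConj L) 3).cuspFormsToLp μ 𝔓 ψ, corr⟫_ℂ = 0) :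
    ∀ f ∈ resGMidAtomGen L μ ξ μω K' ω, ∀ u ∈ (quasiSplit (↥(maximalRealSubfield L)) L (IsCMField.complexConj L) 3).cuspidalSubspace μ 𝔓, ⟪(u : (quasiSplit (↥(maximalRealSubfield L)) L (IsCMField.complexConj L) 3).L2 μ), f⟫_ℂ = 0 := by
  intro f hf
  obtain ⟨φ, M, Ec, P, T, Fam, corr, hφ, hφc, hφM, hPc, hPcd, hP2, hE2, hT, hFd, hFam, hMbd, hdec, hlim, hcorr⟩ := hL f hf
  exact inner_cuspidal_eq_zero_of_truncatedFamily_exports L μ 𝔓 i h𝔓 ν h𝓕N h𝓕c ξ.hψ hφ hφc hφM hPc hPcd hP2 hE2 hT Fam hFd hFam hMbd hdec f ⟨corr, hlim, hcorr⟩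

/-- **ATOM LEVEL**: under the same per-generator exports package + `{hMbd, hdec, hRES}`, `resGMidAtom ξ μω K′ ω ≤ (L²_cusp)ᗮ` (the atom is the closed span of its generators and
`(L²_cusp)ᗮ` is closed — ★ p862741 `resGMidAtom_le_of_gen_subset`), i.e. ★ `resGMidAtom_le_orthogonal_cuspidal_of_letters` with (b) gone and (a) reduced.
[cite: MoeglinWaldspurger1995, V.3.13, IV.1.11] [cite: Rogawski1990, §13.9 p. 229 (ii)] -/
theorem resGMidAtom_le_orthogonal_cuspidal_of_exportsLetters (i : 𝔓.ι)
    (h𝔓 : 𝔓.radical i = adelicUnipotent (↥(maximalRealSubfield L)) L (IsCMField.complexConj L) 3)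
    (ν : Measure ↥(adelicUnipotent (↥(maximalRealSubfield L)) L (IsCMField.complexConj L) 3)) [ν.IsHaarMeasure]
    {𝓕 : Set ↥(adelicUnipotent (↥(maximalRealSubfield L)) L (IsCMField.complexConj L) 3)}
    (h𝓕N : IsFundamentalDomain ↥(rationalUnipotent (↥(maximalRealSubfield L)) L (IsCMField.complexConj L) 3) 𝓕 ν) (h𝓕c : IsCompact (closure 𝓕))
    (hL : ∀ f ∈ resGMidAtomGen L μ ξ μω K' ω,
      ∃ (φ : (quasiSplit (↥(maximalRealSubfield L)) L (IsCMField.complexConj L) 3).Adelic → ℂ) (M : ℝ) (Ec : ℂ → (quasiSplit (↥(maximalRealSubfield L)) L (IsCMField.complexConj L) 3).Adelic → ℂ) (P : Set ℂ) (T : ℝ≥0) (Fam : ℂ → (quasiSplit (↥(maximalRealSubfield L)) L (IsCMField.complexConj L) 3).L2 μ) (corr : (quasiSplit (↥(maximalRealSubfield L)) L (IsCMField.complexConj L) 3).L2 μ),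
        IsChiSectionPair (F := ↥(maximalRealSubfield L)) (ξ.bcη⁻¹ * ξ.bcψ⁻¹ * μω) ξ.ψ φ ∧ Continuous φ ∧ (∀ x, ‖φ x‖ ≤ M) ∧
        IsClosed P ∧ (∀ z₀ : ℂ, ∀ᶠ s in 𝓝[≠] z₀, s ∉ P) ∧ (∀ z ∈ P, z.re ≤ 2) ∧ (∀ z : ℂ, 2 < z.re → Ec z = eisensteinSeriesU (flatSectionU φ z)) ∧
        1 ≤ T ∧ DifferentiableOn ℂ Fam Pᶜ ∧
        (∀ z : ℂ, z ∉ P → ((Fam z : (quasiSplit (↥(maximalRealSubfield L)) L (IsCMField.complexConj L) 3).L2 μ) : (quasiSplit (↥(maximalRealSubfield L)) L (IsCMField.complexConj L) 3).automorphicQuotient → ℂ) =ᵐ[μ] (quasiSplit (↥(maximalRealSubfield L)) L (IsCMField.complexConj L) 3).quotFun (truncation ν 𝓕 T (Ec z))) ∧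
        (∀ z : ℂ, z ∉ P → 2 < z.re → ∃ C : ℝ, ∀ g : (quasiSplit (↥(maximalRealSubfield L)) L (IsCMField.complexConj L) 3).Adelic, T < borelHeight g →
          ‖borelConstantTerm ν 𝓕 (eisensteinSeriesU (flatSectionU φ z)) g - flatSectionU φ z g‖ ≤ C) ∧
        (∀ σ : ℝ, 2 < σ → ∃ M₁ : ℝ, ∀ g : (quasiSplit (↥(maximalRealSubfield L)) L (IsCMField.complexConj L) 3).Adelic, T < borelHeight g →
          ‖eisensteinSeriesU (flatSectionU (fun _ : (quasiSplit (↥(maximalRealSubfield L)) L (IsCMField.complexConj L) 3).Adelic => ((M : ℝ) : ℂ)) ((σ : ℝ) : ℂ)) g -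
            borelConstantTerm ν 𝓕 (eisensteinSeriesU (flatSectionU (fun _ : (quasiSplit (↥(maximalRealSubfield L)) L (IsCMField.complexConj L) 3).Adelic => ((M : ℝ) : ℂ)) ((σ : ℝ) : ℂ))) g‖ ≤ M₁) ∧
        Tendsto (fun z : ℂ => (z - (3 : ℂ) / 2) • Fam z + corr) (𝓝[≠] ((3 : ℂ) / 2)) (𝓝 f) ∧
        ∀ ψ : ↥((quasiSplit (↥(maximalRealSubfield L)) L (IsCMField.complexConj L) 3).cuspForms μ 𝔓), ⟪(quasiSplit (↥(maximalRealSubfield L)) L (IsCMField.complexConj L) 3).cuspFormsToLp μ 𝔓 ψ, corr⟫_ℂ = 0) :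
    resGMidAtom L μ ξ μω K' ω ≤ ((quasiSplit (↥(maximalRealSubfield L)) L (IsCMField.complexConj L) 3).cuspidalSubspace μ 𝔓).toSubmoduleᗮ :=
  resGMidAtom_le_of_gen_subset L μ ξ μω K' ω _ (Submodule.isClosed_orthogonal _) fun f hf =>
    (Submodule.mem_orthogonal _ f).2 fun u hu =>
      resGMidAtomGen_inner_cuspidal_eq_zero_of_exportsLetters L μ 𝔓 ξ μω K' ω i h𝔓 ν h𝓕N h𝓕c hL f hf u hu

/-! ## §3 (EDITION 2) Letters (a)+(b) FULLY PAID: `hMbd` by ★ `hMbd_pair_cm_three`, (Tr) by ★ `hTr_cm_three_free` — only the residue letter `hRES` remains -/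

/-- **ED. 2 — `⟪u, f⟫ = 0` FOR EVERY `u ∈ L²_cusp`, FROM THE χ-EXPORTS WITH THE TRUNCATED FAMILY, MODULO `hRES` ALONE** — §1 with the [MW II.1.7] tail letter PAID by ★ `hMbd_pair_cm_three`
(LH4-p10 (g9); same pair-section data) and the spherical (Tr) letter PAID letter-free by ★ `hTr_cm_three_free` (K2E2-p12 (g9); domination), so letters (a) and (b) of ★
`resGMidAtomGen_inner_cuspidal_eq_zero_of_letters` are discharged from the exports outright and the ONLY visible letter is the `L²` residue letter `hRES` ((c)+(d)).
[cite: MoeglinWaldspurger1995, IV.1.11, II.1.7–II.1.8, I.2.13] [cite: BernsteinLapid2019, §4 Claim 2] [cite: Rogawski1990, §13.9 p. 229 (ii)] [cite: Conway1978, IV §3] -/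
theorem inner_cuspidal_eq_zero_of_truncatedFamily_exports_free (i : 𝔓.ι)
    (h𝔓 : 𝔓.radical i = adelicUnipotent (↥(maximalRealSubfield L)) L (IsCMField.complexConj L) 3)
    (ν : Measure ↥(adelicUnipotent (↥(maximalRealSubfield L)) L (IsCMField.complexConj L) 3)) [ν.IsHaarMeasure]
    {𝓕 : Set ↥(adelicUnipotent (↥(maximalRealSubfield L)) L (IsCMField.complexConj L) 3)}
    (h𝓕N : IsFundamentalDomain ↥(rationalUnipotent (↥(maximalRealSubfield L)) L (IsCMField.complexConj L) 3) 𝓕 ν) (h𝓕c : IsCompact (closure 𝓕))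
    {χ₁ : HeckeCharacter L} {χ₂ : ↥(TorusDict.torus (IsCMField.complexConj L)) →ₜ* ℂˣ} (hχ₂ : TorusDict.IsAutomorphic (IsCMField.complexConj L) χ₂)
    {φ : (quasiSplit (↥(maximalRealSubfield L)) L (IsCMField.complexConj L) 3).Adelic → ℂ}
    (hφ : IsChiSectionPair (F := ↥(maximalRealSubfield L)) χ₁ χ₂ φ) (hφc : Continuous φ) {M : ℝ} (hφM : ∀ x, ‖φ x‖ ≤ M)
    {Ec : ℂ → (quasiSplit (↥(maximalRealSubfield L)) L (IsCMField.complexConj L) 3).Adelic → ℂ} {P : Set ℂ}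
    (hPc : IsClosed P) (hPcd : ∀ z₀ : ℂ, ∀ᶠ s in 𝓝[≠] z₀, s ∉ P) (hP2 : ∀ z ∈ P, z.re ≤ 2)
    (hE2 : ∀ z : ℂ, 2 < z.re → Ec z = eisensteinSeriesU (flatSectionU φ z))
    {T : ℝ≥0} (hT : 1 ≤ T) (Fam : ℂ → (quasiSplit (↥(maximalRealSubfield L)) L (IsCMField.complexConj L) 3).L2 μ) (hFd : DifferentiableOn ℂ Fam Pᶜ)
    (hFam : ∀ z : ℂ, z ∉ P → ((Fam z : (quasiSplit (↥(maximalRealSubfield L)) L (IsCMField.complexConj L) 3).L2 μ) : (quasiSplit (↥(maximalRealSubfield L)) L (IsCMField.complexConj L) 3).automorphicQuotient → ℂ) =ᵐ[μ] (quasiSplit (↥(maximalRealSubfield L)) L (IsCMField.complexConj L) 3).quotFun (truncation ν 𝓕 T (Ec z)))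
    (f : (quasiSplit (↥(maximalRealSubfield L)) L (IsCMField.complexConj L) 3).L2 μ)
    (hRES : ∃ corr : (quasiSplit (↥(maximalRealSubfield L)) L (IsCMField.complexConj L) 3).L2 μ,
      Tendsto (fun z : ℂ => (z - (3 : ℂ) / 2) • Fam z + corr) (𝓝[≠] ((3 : ℂ) / 2)) (𝓝 f) ∧
      ∀ ψ : ↥((quasiSplit (↥(maximalRealSubfield L)) L (IsCMField.complexConj L) 3).cuspForms μ 𝔓), ⟪(quasiSplit (↥(maximalRealSubfield L)) L (IsCMField.complexConj L) 3).cuspFormsToLp μ 𝔓 ψ, corr⟫_ℂ = 0) :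
    ∀ u ∈ (quasiSplit (↥(maximalRealSubfield L)) L (IsCMField.complexConj L) 3).cuspidalSubspace μ 𝔓, ⟪(u : (quasiSplit (↥(maximalRealSubfield L)) L (IsCMField.complexConj L) 3).L2 μ), f⟫_ℂ = 0 := by
  obtain ⟨corr, hlim, hcorr⟩ := hRES
  have hDo : IsOpen Pᶜ := hPc.isOpen_compl
  have hDc : IsPreconnected Pᶜ := isPreconnected_compl_of_codiscrete hPcd
  have hσD : ∀ᶠ z in 𝓝 (((3 : ℝ) : ℝ) : ℂ), z ∈ Pᶜ := by
    have hopen : ∀ᶠ z in 𝓝 (((3 : ℝ) : ℝ) : ℂ), 2 < z.re :=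
      (Complex.continuous_re.isOpen_preimage _ isOpen_Ioi).mem_nhds (by simp only [mem_preimage, Complex.ofReal_re, mem_Ioi]; norm_num)
    filter_upwards [hopen] with z hz hzP
    exact absurd (hP2 z hzP) (not_le.2 hz)
  have hD32 : ∀ᶠ z in 𝓝[≠] ((3 : ℂ) / 2), z ∈ Pᶜ := hPcd _
  have hseed := tubeSeed_pair_cm_three_of_letters L μ ν h𝓕N h𝓕c 𝔓 i h𝔓 hχ₂ hφ hφc hφM hT Ec Pᶜ (fun z _ hz => hE2 z hz)
    (hMbd_pair_cm_three L ν h𝓕N h𝓕c hχ₂ hφ hφc hφM hT Pᶜ) (hTr_cm_three_free L ν h𝓕N h𝓕c M hT μ) Fam (fun z hz => hFam z hz)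
  exact inner_eq_zero_of_mem_cuspidalSubspace_of_forall_cuspFormsToLp L μ 𝔓 f
    (inner_cuspFormsToLp_eq_zero_of_midResidue_letters L μ 𝔓 Fam hDo hDc hFd (by norm_num : (2 : ℝ) < 3) hσD hD32 hseed f corr hlim hcorr)

/-- **ED. 2 — ★ p862741's `hcusp` BYTES AT ONE LEVEL `(K′, ω)`, FROM THE EXPORTS PACKAGE + THE RESIDUE LETTER ALONE**: §2's head with the `hMbd`-row and the `hdec`-row DELETED from
the per-generator package (paid by ★ `hMbd_pair_cm_three` ∕ ★ `hTr_cm_three_free`). [cite: MoeglinWaldspurger1995, IV.1.11, V.3.13] [cite: Rogawski1990, §13.9 p. 229 (ii)]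
[cite: BernsteinLapid2019, §4 Claim 2] -/
theorem resGMidAtomGen_inner_cuspidal_eq_zero_of_exportsResidueLetter (i : 𝔓.ι)
    (h𝔓 : 𝔓.radical i = adelicUnipotent (↥(maximalRealSubfield L)) L (IsCMField.complexConj L) 3)
    (ν : Measure ↥(adelicUnipotent (↥(maximalRealSubfield L)) L (IsCMField.complexConj L) 3)) [ν.IsHaarMeasure]
    {𝓕 : Set ↥(adelicUnipotent (↥(maximalRealSubfield L)) L (IsCMField.complexConj L) 3)}
    (h𝓕N : IsFundamentalDomain ↥(rationalUnipotent (↥(maximalRealSubfield L)) L (IsCMField.complexConj L) 3) 𝓕 ν) (h𝓕c : IsCompact (closure 𝓕))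
    (hL : ∀ f ∈ resGMidAtomGen L μ ξ μω K' ω,
      ∃ (φ : (quasiSplit (↥(maximalRealSubfield L)) L (IsCMField.complexConj L) 3).Adelic → ℂ) (M : ℝ) (Ec : ℂ → (quasiSplit (↥(maximalRealSubfield L)) L (IsCMField.complexConj L) 3).Adelic → ℂ) (P : Set ℂ) (T : ℝ≥0) (Fam : ℂ → (quasiSplit (↥(maximalRealSubfield L)) L (IsCMField.complexConj L) 3).L2 μ) (corr : (quasiSplit (↥(maximalRealSubfield L)) L (IsCMField.complexConj L) 3).L2 μ),
        IsChiSectionPair (F := ↥(maximalRealSubfield L)) (ξ.bcη⁻¹ * ξ.bcψ⁻¹ * μω) ξ.ψ φ ∧ Continuous φ ∧ (∀ x, ‖φ x‖ ≤ M) ∧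
        IsClosed P ∧ (∀ z₀ : ℂ, ∀ᶠ s in 𝓝[≠] z₀, s ∉ P) ∧ (∀ z ∈ P, z.re ≤ 2) ∧ (∀ z : ℂ, 2 < z.re → Ec z = eisensteinSeriesU (flatSectionU φ z)) ∧
        1 ≤ T ∧ DifferentiableOn ℂ Fam Pᶜ ∧
        (∀ z : ℂ, z ∉ P → ((Fam z : (quasiSplit (↥(maximalRealSubfield L)) L (IsCMField.complexConj L) 3).L2 μ) : (quasiSplit (↥(maximalRealSubfield L)) L (IsCMField.complexConj L) 3).automorphicQuotient → ℂ) =ᵐ[μ] (quasiSplit (↥(maximalRealSubfield L)) L (IsCMField.complexConj L) 3).quotFun (truncation ν 𝓕 T (Ec z))) ∧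
        Tendsto (fun z : ℂ => (z - (3 : ℂ) / 2) • Fam z + corr) (𝓝[≠] ((3 : ℂ) / 2)) (𝓝 f) ∧
        ∀ ψ : ↥((quasiSplit (↥(maximalRealSubfield L)) L (IsCMField.complexConj L) 3).cuspForms μ 𝔓), ⟪(quasiSplit (↥(maximalRealSubfield L)) L (IsCMField.complexConj L) 3).cuspFormsToLp μ 𝔓 ψ, corr⟫_ℂ = 0) :
    ∀ f ∈ resGMidAtomGen L μ ξ μω K' ω, ∀ u ∈ (quasiSplit (↥(maximalRealSubfield L)) L (IsCMField.complexConj L) 3).cuspidalSubspace μ 𝔓, ⟪(u : (quasiSplit (↥(maximalRealSubfield L)) L (IsCMField.complexConj L) 3).L2 μ), f⟫_ℂ = 0 := by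
  intro f hf
  obtain ⟨φ, M, Ec, P, T, Fam, corr, hφ, hφc, hφM, hPc, hPcd, hP2, hE2, hT, hFd, hFam, hlim, hcorr⟩ := hL f hf
  exact inner_cuspidal_eq_zero_of_truncatedFamily_exports_free L μ 𝔓 i h𝔓 ν h𝓕N h𝓕c ξ.hψ hφ hφc hφM hPc hPcd hP2 hE2 hT Fam hFd hFam f ⟨corr, hlim, hcorr⟩

/-- **ED. 2 — ATOM LEVEL, EXPORTS PACKAGE + RESIDUE LETTER ALONE**: `resGMidAtom ξ μω K′ ω ≤ (L²_cusp)ᗮ` (★ `resGMidAtom_le_of_gen_subset`).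
[cite: MoeglinWaldspurger1995, V.3.13, IV.1.11] [cite: Rogawski1990, §13.9 p. 229 (ii)] -/
theorem resGMidAtom_le_orthogonal_cuspidal_of_exportsResidueLetter (i : 𝔓.ι)
    (h𝔓 : 𝔓.radical i = adelicUnipotent (↥(maximalRealSubfield L)) L (IsCMField.complexConj L) 3)
    (ν : Measure ↥(adelicUnipotent (↥(maximalRealSubfield L)) L (IsCMField.complexConj L) 3)) [ν.IsHaarMeasure]
    {𝓕 : Set ↥(adelicUnipotent (↥(maximalRealSubfield L)) L (IsCMField.complexConj L) 3)}
    (h𝓕N : IsFundamentalDomain ↥(rationalUnipotent (↥(maximalRealSubfield L)) L (IsCMField.complexConj L) 3) 𝓕 ν) (h𝓕c : IsCompact (closure 𝓕))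
    (hL : ∀ f ∈ resGMidAtomGen L μ ξ μω K' ω,
      ∃ (φ : (quasiSplit (↥(maximalRealSubfield L)) L (IsCMField.complexConj L) 3).Adelic → ℂ) (M : ℝ) (Ec : ℂ → (quasiSplit (↥(maximalRealSubfield L)) L (IsCMField.complexConj L) 3).Adelic → ℂ) (P : Set ℂ) (T : ℝ≥0) (Fam : ℂ → (quasiSplit (↥(maximalRealSubfield L)) L (IsCMField.complexConj L) 3).L2 μ) (corr : (quasiSplit (↥(maximalRealSubfield L)) L (IsCMField.complexConj L) 3).L2 μ),
        IsChiSectionPair (F := ↥(maximalRealSubfield L)) (ξ.bcη⁻¹ * ξ.bcψ⁻¹ * μω) ξ.ψ φ ∧ Continuous φ ∧ (∀ x, ‖φ x‖ ≤ M) ∧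
        IsClosed P ∧ (∀ z₀ : ℂ, ∀ᶠ s in 𝓝[≠] z₀, s ∉ P) ∧ (∀ z ∈ P, z.re ≤ 2) ∧ (∀ z : ℂ, 2 < z.re → Ec z = eisensteinSeriesU (flatSectionU φ z)) ∧
        1 ≤ T ∧ DifferentiableOn ℂ Fam Pᶜ ∧
        (∀ z : ℂ, z ∉ P → ((Fam z : (quasiSplit (↥(maximalRealSubfield L)) L (IsCMField.complexConj L) 3).L2 μ) : (quasiSplit (↥(maximalRealSubfield L)) L (IsCMField.complexConj L) 3).automorphicQuotient → ℂ) =ᵐ[μ] (quasiSplit (↥(maximalRealSubfield L)) L (IsCMField.complexConj L) 3).quotFun (truncation ν 𝓕 T (Ec z))) ∧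
        Tendsto (fun z : ℂ => (z - (3 : ℂ) / 2) • Fam z + corr) (𝓝[≠] ((3 : ℂ) / 2)) (𝓝 f) ∧
        ∀ ψ : ↥((quasiSplit (↥(maximalRealSubfield L)) L (IsCMField.complexConj L) 3).cuspForms μ 𝔓), ⟪(quasiSplit (↥(maximalRealSubfield L)) L (IsCMField.complexConj L) 3).cuspFormsToLp μ 𝔓 ψ, corr⟫_ℂ = 0) :
    resGMidAtom L μ ξ μω K' ω ≤ ((quasiSplit (↥(maximalRealSubfield L)) L (IsCMField.complexConj L) 3).cuspidalSubspace μ 𝔓).toSubmoduleᗮ :=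
  resGMidAtom_le_of_gen_subset L μ ξ μω K' ω _ (Submodule.isClosed_orthogonal _) fun f hf =>
    (Submodule.mem_orthogonal _ f).2 fun u hu =>
      resGMidAtomGen_inner_cuspidal_eq_zero_of_exportsResidueLetter L μ 𝔓 ξ μω K' ω i h𝔓 ν h𝓕N h𝓕c hL f hf u hu

end Summit.HodgeConjecture.HodgeConjecture.R90.S8

end
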